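import Literature.NumberTheory.Transcendental.KZCubicalCalculus
import Summits.KontsevichZagierPeriods.KontsevichZagierPeriods.Theorems.InverseLandauTateFamilyKernelTameCertificate
import Literature.NumberTheory.Transcendental.KZLogCalculusProofs
import Literature.NumberTheory.Transcendental.SemialgebraicLineDeriv
import Mathlib.MeasureTheory.Integral.IntervalIntegral.FundThmCalculus
import Mathlib.MeasureTheory.Integral.IntervalIntegral.Basic
import Mathlib.Analysis.Calculus.FDeriv.Analytic

/-!
# `DilationTransfer` in dimension `≤ 1` — II. Moves: reading along constant vectors, the dilation
integral, and one Newton–Leibniz move for a tame representation on `[0,1]¹`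

Support file for crux `DilationTransfer` (stmt-KontsevichZagierPeriods-3572, route `LiftingCriteria`,
line `birth`), toolkit of part III (`LiftingCriteriaDilationTransferDimLeOne.lean`):
* `integral_dilate_dim_le_one`: `∫_{[0,1]ᵏ} F(ϖz) dz = ∫₀¹ F(ϖt·𝟙) dt` for `k ≤ 1`, and the change of
  variables `∫₀¹ γ(ϖt)dt = ϖ⁻¹∫₀^ϖ γ` (`integral_dilate_eq_inv_mul`); FTC-1 for `∫₀ˣ γ`
  (`hasDerivAt_primitive`);
* reading Nash data of dimension `k` along `t ↦ (a t₀, …, a t₀)` keeps analyticity and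
  `ℚ`-semialgebraicity (`analyticAt_comp_constVec(_mul)`, `isSemialgebraicFunOn_comp_constVec_mul`), and
  a representation `[[0,1]ᵏ, g(a·)]`, `k ≤ 1`, is KZ-equivalent to the tame representation
  `[[0,1]¹, g(a z₀, …)]` (`tame_read_dim_le_one`);
* registered sub-goal `stub_dimOneNewtonLeibniz`: a TAME representation `[[0,1]¹, φ(z₀)]` whose
  integrand has a continuous `ℚ`-semialgebraic primitive `Π` on `[0,1]` (`Π′ = φ` on `(0,1)`) with
  `Π 1 = Π 0` is a relation — one Newton–Leibniz move (printed rule (3)) from the zero point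
  representation.

## References
* M. Kontsevich, D. Zagier, *Periods* (2001), §1.2.
* J. Ayoub, *Periods and the conjectures of Grothendieck and Kontsevich–Zagier* (2014), Def. 10, Rem. 13.
-/

noncomputable section

open scoped BigOperators
open Set MeasureTheory Filter
open Literature.NumberTheory.Transcendental
open Literature.ModelTheory.ExponentialFields (IsSemialgebraic)

namespace Summit.KontsevichZagierPeriods.LiftingCriteria.DilationTransferDimOne


/-! ### One-variable reading of data of dimension `≤ 1` -/

/-- **The dilation integral in dimension `≤ 1`**: `∫_{[0,1]ᵏ} F(ϖz) dz = ∫₀¹ F(ϖt·𝟙) dt` for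
`k ≤ 1` (for `k = 1` the volume-preserving `MeasurableEquiv.funUnique`; for `k = 0` both sides are
the value of `F` at the point). [folklore] -/
theorem integral_dilate_dim_le_one {k : ℕ} (hk : k ≤ 1) (F : (Fin k → ℝ) → ℝ) (ϖ : ℝ) :
    (∫ z in Set.pi Set.univ (fun _ : Fin k => Set.Icc (0:ℝ) 1), F (ϖ • z)) =
      ∫ t in (0:ℝ)..1, F (fun _ => ϖ * t) := by
  rcases Nat.le_one_iff_eq_zero_or_eq_one.mp hk with rfl | rfl
  · -- dimension 0: a point of volume 1
    have hconst : ∀ z : Fin 0 → ℝ, ∀ t : ℝ, F (ϖ • z) = F (fun _ => ϖ * t) := fun z t =>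
      congrArg F (funext fun l => l.elim0)
    have hpi : Set.pi Set.univ (fun _ : Fin 0 => Set.Icc (0:ℝ) 1) = Set.univ :=
      Set.eq_univ_of_forall fun z => Set.mem_univ_pi.mpr fun l => l.elim0
    rw [hpi, Measure.restrict_univ, MeasureTheory.volume_pi,
      Measure.pi_of_empty (fun _ => (volume : Measure ℝ)) (fun l => l.elim0), integral_dirac]
    rw [intervalIntegral.integral_of_le zero_le_one]
    have : (fun t : ℝ => F (fun _ => ϖ * t)) = fun _ => F (ϖ • fun l => l.elim0) :=
      funext fun t => (hconst _ t).symm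
    rw [this, setIntegral_const]
    simp
  · -- dimension 1: transfer along `funUnique`
    have hmp : MeasurePreserving (MeasurableEquiv.funUnique (Fin 1) ℝ) volume volume :=
      volume_preserving_funUnique (Fin 1) ℝ
    have hset : Set.pi Set.univ (fun _ : Fin 1 => Set.Icc (0:ℝ) 1) =
        (MeasurableEquiv.funUnique (Fin 1) ℝ) ⁻¹' Set.Icc 0 1 := by
      ext z
      simp only [Set.mem_univ_pi, Fin.forall_fin_one, Set.mem_preimage]
      simp [MeasurableEquiv.funUnique, Fin.default_eq_zero]
    have key : (∫ z in Set.pi Set.univ (fun _ : Fin 1 => Set.Icc (0:ℝ) 1), F (ϖ • z)) =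
        ∫ y in Set.Icc (0:ℝ) 1, F (fun _ => ϖ * y) := by
      rw [hset, ← hmp.setIntegral_preimage_emb (MeasurableEquiv.funUnique (Fin 1) ℝ).measurableEmbedding
        (fun y : ℝ => F (fun _ => ϖ * y)) (Set.Icc 0 1)]
      refine setIntegral_congr_fun ((MeasurableEquiv.measurableSet_preimage _).mpr measurableSet_Icc)
        fun z _ => congrArg F (funext fun l => ?_)
      rw [Subsingleton.elim l 0]
      simp [MeasurableEquiv.funUnique, Fin.default_eq_zero]
    rw [key, integral_Icc_eq_integral_Ioc, ← intervalIntegral.integral_of_le zero_le_one]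


/-- **Change of variables in the dilation integral**: `∫₀¹ γ(ϖt) dt = ϖ⁻¹ ∫₀^ϖ γ` for `ϖ ≠ 0`.
[folklore] -/
theorem integral_dilate_eq_inv_mul (γ : ℝ → ℝ) {ϖ : ℝ} (hϖ : ϖ ≠ 0) :
    (∫ t in (0:ℝ)..1, γ (ϖ * t)) = ϖ⁻¹ * ∫ y in (0:ℝ)..ϖ, γ y := by
  rw [intervalIntegral.integral_comp_mul_left γ hϖ, mul_zero, mul_one, smul_eq_mul]

/-- **Primitives of functions continuous near `[0,1]`** (FTC-1): if `γ` is continuous on an open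
`J ⊇ [0,1]`, then `x ↦ ∫₀ˣ γ` has derivative `γ x` at every `x ∈ [0,1]`. [folklore] -/
theorem hasDerivAt_primitive {γ : ℝ → ℝ} {J : Set ℝ} (hJ : IsOpen J) (hsub : Set.Icc (0:ℝ) 1 ⊆ J)
    (hγ : ContinuousOn γ J) {x : ℝ} (hx : x ∈ Set.Icc (0:ℝ) 1) :
    HasDerivAt (fun u => ∫ y in (0:ℝ)..u, γ y) (γ x) x := by
  have hint : IntervalIntegrable γ volume 0 x :=
    (hγ.mono ((Set.uIcc_of_le hx.1).symm ▸ (Set.Icc_subset_Icc_right hx.2).trans hsub)).intervalIntegrable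
  exact intervalIntegral.integral_hasDerivAt_right hint (hγ.stronglyMeasurableAtFilter hJ x (hsub hx))
    (hγ.continuousAt (hJ.mem_nhds (hsub hx)))

/-! ### Reading `ℚ`-semialgebraic / analytic data of dimension `≤ 1` along constant vectors -/

/-- The constant-vector map `y ↦ (y, …, y) : ℝ → ℝᵏ` is continuous. [folklore] -/
theorem continuous_constVec (k : ℕ) : Continuous fun y : ℝ => (fun _ : Fin k => y) :=
  continuous_pi fun _ => continuous_id

/-- A function analytic at the constant vector `(y, …, y)` is, read along constant vectors,
analytic at `y`. [folklore] -/
theorem analyticAt_comp_constVec {k : ℕ} {g : (Fin k → ℝ) → ℝ} {y : ℝ}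
    (hg : AnalyticAt ℝ g (fun _ : Fin k => y)) : AnalyticAt ℝ (fun y : ℝ => g (fun _ : Fin k => y)) y := by
  obtain ⟨L, hL⟩ : ∃ L : ℝ →L[ℝ] (Fin k → ℝ), ∀ y, L y = fun _ => y :=
    ⟨ContinuousLinearMap.pi fun _ => ContinuousLinearMap.id ℝ ℝ, fun y => by ext; simp⟩
  have h : AnalyticAt ℝ g (L y) := by rw [hL]; exact hg
  exact (h.comp (L.analyticAt y)).congr (Filter.Eventually.of_forall fun y' => by simp [hL])

/-- A function analytic at `(a·y, …, a·y)` gives, along `z ↦ g(a z₀, …, a z₀)` on `ℝ¹`, a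
function analytic at `z`. [folklore] -/
theorem analyticAt_comp_constVec_mul {k : ℕ} {g : (Fin k → ℝ) → ℝ} (a : ℝ) {z : Fin 1 → ℝ}
    (hg : AnalyticAt ℝ g (fun _ : Fin k => a * z 0)) :
    AnalyticAt ℝ (fun z : Fin 1 → ℝ => g (fun _ : Fin k => a * z 0)) z := by
  obtain ⟨L, hL⟩ : ∃ L : (Fin 1 → ℝ) →L[ℝ] (Fin k → ℝ), ∀ z, L z = fun _ => a * z 0 :=
    ⟨ContinuousLinearMap.pi fun _ => a • ContinuousLinearMap.proj 0, fun z => by ext; simp⟩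
  have h : AnalyticAt ℝ g (L z) := by rw [hL]; exact hg
  exact (h.comp (L.analyticAt z)).congr (Filter.Eventually.of_forall fun z' => by simp [hL])

/-- Reading a `ℚ`-semialgebraic function of `k` variables along the `ℚ`-semialgebraic map
`t ↦ (a t₀, …, a t₀)` (`a ∈ ℚ`) from a `ℚ`-semialgebraic `s ⊆ ℝ¹` mapped into its domain gives a
`ℚ`-semialgebraic function on `s`. [cite: BochnakCosteRoy1998, Prop. 2.2.6] -/
theorem isSemialgebraicFunOn_comp_constVec_mul {k : ℕ} {g : (Fin k → ℝ) → ℝ} {Ug : Set (Fin k → ℝ)}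
    (hgs : IsSemialgebraicFunOn ℚ Ug g) (a : ℚ) {s : Set (Fin 1 → ℝ)} (hs : IsSemialgebraic ℚ s)
    (hmaps : ∀ t ∈ s, (fun _ : Fin k => (a : ℝ) * t 0) ∈ Ug) :
    IsSemialgebraicFunOn ℚ s fun t => g (fun _ : Fin k => (a : ℝ) * t 0) :=
  IsSemialgebraicFunOn.comp_isSemialgebraicMapOn_holds hgs
    (IsSemialgebraicMapOn.of_forall hs fun _ =>
      ((isSemialgebraicFunOn_const_ratCast hs a).fun_mul (isSemialgebraicFunOn_apply hs 0)))
    hmaps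

/-- **Reading a representation of dimension `≤ 1` as a tame representation on `[0,1]¹`**: if
`ρ = [[0,1]ᵏ, g(a·)]` (`k ≤ 1`, `g` Nash near `[0,1]ᵏ`, `0 ≤ a ≤ 1`) and `τ` is the tame cube
representation of `z ↦ g(a z₀, …, a z₀)` on `[0,1]¹`, then `[τ] − [ρ] ∈ KZ.relations` (for `k = 1`
a congruence, for `k = 0` the padding move `tame_liftLast`). [cite: KontsevichZagier2001, §1.2] -/
theorem tame_read_dim_le_one {k : ℕ} (hk : k ≤ 1) (g : (Fin k → ℝ) → ℝ) (Ug : Set (Fin k → ℝ))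
    (hUc : Set.pi Set.univ (fun _ : Fin k => Set.Icc (0:ℝ) 1) ⊆ Ug) (hgs : IsSemialgebraicFunOn ℚ Ug g)
    (a : ℝ) (ρ : KZ.IntegralRep k) (hρd : ρ.domain = Set.pi Set.univ (fun _ : Fin k => Set.Icc (0:ℝ) 1))
    (hρi : ∀ z ∈ Set.pi Set.univ (fun _ : Fin k => Set.Icc (0:ℝ) 1), ρ.integrand z = g (a • z))
    (τ : KZ.IntegralRep 1) (hτ : τ.IsTameCube)
    (hτi : ∀ z ∈ KZ.cube 1, τ.integrand z = g (fun _ : Fin k => a * z 0)) :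
    KZ.of τ - KZ.of ρ ∈ KZ.relations := by
  rcases Nat.le_one_iff_eq_zero_or_eq_one.mp hk with rfl | rfl
  · -- dimension 0: `ρ` is the constant `g(pt)` at the point, `τ` the same constant on `[0,1]¹`
    set z₀ : Fin 0 → ℝ := fun l => l.elim0 with hz₀
    have hall : ∀ z : Fin 0 → ℝ, z = z₀ := fun z => funext fun l => l.elim0
    have hpi : Set.pi Set.univ (fun _ : Fin 0 => Set.Icc (0:ℝ) 1) = Set.univ :=
      Set.eq_univ_of_forall fun z => Set.mem_univ_pi.mpr fun l => l.elim0
    have hρint : ρ.integrand = fun _ => g z₀ := by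
      funext z
      rw [hρi z (by rw [hpi]; trivial), hall (a • z)]
    have hρt : ρ.IsTameCube :=
      ⟨by rw [hρd, hpi, KZ.cube_zero], by rw [hρint]; exact analyticOnNhd_const⟩
    have hgs0 : IsSemialgebraicFunOn ℚ (KZ.cube 0) (fun _ : Fin 0 → ℝ => g z₀) :=
      (hgs.mono (fun z _ => hUc (by rw [hpi]; trivial)) KZ.isSemialgebraic_cube).congr
        fun z _ => by rw [hall z]
    exact Summit.KontsevichZagierPeriods.InverseLandau.TateFamilyKernel.tame_liftLast
      (u := fun _ : Fin 0 → ℝ => g z₀) analyticOnNhd_const hgs0 τ hτ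
      (fun w hw => by rw [hτi w hw, hall (fun _ : Fin 0 => a * w 0)]) ρ hρt
      (fun x _ => by rw [hρint])
  · -- dimension 1: congruence of integrands on the same domain
    refine KZ.of_sub_of_mem_relations_of_eqOn (by rw [hρd, hτ.1, KZ.cube_eq_pi]) fun z hz => ?_
    rw [hτ.1] at hz
    have hz' : z ∈ Set.pi Set.univ (fun _ : Fin 1 => Set.Icc (0:ℝ) 1) := by rwa [← KZ.cube_eq_pi]
    rw [hτi z hz, hρi z hz']
    exact congrArg g (funext fun l => by rw [Subsingleton.elim l 0]; rfl)

/-- **One Newton–Leibniz move on `[0,1]¹` from the point, for a TAME representation** (registered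
sub-goal `stub_dimOneNewtonLeibniz` of crux stmt-KontsevichZagierPeriods-3572): if `A` is a
tame cube representation on `[0,1]¹` whose integrand is `z ↦ φ(z₀)` and `Pr` is continuous and
`ℚ`-semialgebraic on `[0,1]` with `Pr' = φ` on `(0,1)` and `Pr 1 = Pr 0`, then `[A] ∈ KZ.relations`
(`[A] − [pt, Pr 1 − Pr 0] ∈ newtonLeibnizRel` and the point representation has integrand `0`).
[cite: KontsevichZagier2001, §1.2 rule (3)] -/
theorem stub_dimOneNewtonLeibniz :
    ∀ (φ Pr : ℝ → ℝ), Literature.NumberTheory.Transcendental.IsSemialgebraicFunOn ℚ {z : Fin 1 → ℝ | z 0 ∈ Set.Icc (0:ℝ) 1} (fun z => Pr (z 0)) → ContinuousOn Pr (Set.Icc (0:ℝ) 1) → (∀ t ∈ Set.Ioo (0:ℝ) 1, HasDerivAt Pr (φ t) t) → Pr 1 = Pr 0 → ∀ (A : Literature.NumberTheory.Transcendental.KZ.IntegralRep 1), A.IsTameCube → (∀ z ∈ Literature.NumberTheory.Transcendental.KZ.cube 1, A.integrand z = φ (z 0)) → Literature.NumberTheory.Transcendental.KZ.of A ∈ Literature.NumberTheory.Transcendental.KZ.relations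 := by
  intro φ Pr hPrs hPrc hPrd hPr01 A hA hAi
  -- the zero point representation
  have hvol : volume (Set.univ : Set (Fin 0 → ℝ)) = 1 := by
    rw [MeasureTheory.volume_pi, Measure.pi_empty_univ]
  let c : KZ.IntegralRep 0 :=
    { domain := Set.univ
      integrand := fun _ => 0
      isSemialgebraic_domain := Literature.ModelTheory.ExponentialFields.isSemialgebraic_univ
      isSemialgebraicFunOn_integrand := by
        simpa using isSemialgebraicFunOn_const_ratCast
          (Literature.ModelTheory.ExponentialFields.isSemialgebraic_univ (k := ℚ) (ι := Fin 0) (R := ℝ)) 0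
      integrableOn := integrableOn_const (hs := by simp [hvol]) }
  have hc : KZ.of c ∈ KZ.relations := KZ.of_mem_relations_of_eqOn_zero c fun _ _ => rfl
  have hNL : KZ.of A - KZ.of c ∈ KZ.newtonLeibnizRel := by
    have hset1 : KZ.cube 1 = {z : Fin 1 → ℝ | z 0 ∈ Set.Icc (0:ℝ) 1} := by
      ext z
      simp only [KZ.mem_cube, Fin.forall_fin_one, Set.mem_setOf_eq, Set.mem_Icc]
    refine ⟨0, A, c, fun _ => (0:ℝ), fun _ => (1:ℝ), fun z => Pr (z (Fin.last 0)),
      by rw [hA.1, hset1]; exact hPrs.congr fun z _ => rfl, ?_, ?_,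
      fun _ _ => zero_le_one, ?_, fun x _ => ?_, fun x _ t ht => ?_, fun x _ => ?_, rfl⟩
    · simpa using isSemialgebraicFunOn_const_ratCast
        (Literature.ModelTheory.ExponentialFields.isSemialgebraic_univ (k := ℚ) (ι := Fin 0) (R := ℝ)) 0
    · simpa using isSemialgebraicFunOn_const_ratCast
        (Literature.ModelTheory.ExponentialFields.isSemialgebraic_univ (k := ℚ) (ι := Fin 0) (R := ℝ)) 1
    · rw [hA.1]
      ext z
      simp only [KZ.mem_cube, Fin.forall_fin_one, Set.mem_setOf_eq]
      exact ⟨fun h => ⟨Set.mem_univ _, h⟩, fun h => h.2⟩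
    · simp only [Fin.snoc_last]
      exact hPrc
    · have hmem : (Fin.snoc x t : Fin 1 → ℝ) ∈ KZ.cube 1 := by
        rw [KZ.mem_cube]
        intro i
        rw [Subsingleton.elim i (Fin.last 0), Fin.snoc_last]
        exact ⟨ht.1.le, ht.2.le⟩
      simp only [Fin.snoc_last, hAi _ hmem]
      rw [show (0 : Fin 1) = Fin.last 0 from rfl, Fin.snoc_last]
      exact hPrd t ht
    · simp only [Fin.snoc_last, hPr01, sub_self]
      rfl
  have h := KZ.relations.add_mem (KZ.newtonLeibnizRel_subset_relations hNL) hc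
  rwa [sub_add_cancel] at h


end Summit.KontsevichZagierPeriods.LiftingCriteria.DilationTransferDimOne
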